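import Literature.NumberTheory.EllipticCurves.WeierstrassScheme
import Literature.NumberTheory.EllipticCurves.GaloisAction
import Literature.AlgebraicGeometry.Motives.HypersurfaceFieldPoints
import Mathlib.AlgebraicGeometry.EllipticCurve.Projective.Point
import HarnessLib

/-!
# Field-valued points of the Weierstrass cubic `E_W`: `E_W(L) = W(L)`

For a Weierstrass curve `W` over a field `K`, a field `L ⊇ K` (`[Algebra K L]`) and the plane
cubic `E_W = V₊(F) ⊂ ℙ²_K` of `Literature/NumberTheory/EllipticCurves/WeierstrassScheme`, the
`L`-valued points `E_W(L)` over `K` (`AlgPoints W.scheme L`, i.e. `K`-morphisms `Spec L → E_W`)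
are the solutions of the homogeneous Weierstrass equation in `ℙ²(L)`:

* `WeierstrassCurve.schemePoint W v hv hEq : AlgPoints W.scheme L` — the point with homogeneous
  coordinates `v ≠ 0` satisfying `(W.baseChange L).toProjective.Equation v`; every point is of this
  form (`exists_eq_schemePoint`), coordinates unique up to `Lˣ` (`schemePoint_eq_schemePoint_iff`),
  and `Aut(L/K)` acts coordinatewise (`smul_schemePoint`) — Silverman, *AEC*, III.1–III.2 (the
  `L`-rational points of `E ⊂ ℙ²` are the solutions `[X, Y, Z] ∈ ℙ²(L)`), I.2 (Galois acts on
  coordinates), via `Motives/HypersurfaceFieldPoints`;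
* for `W` elliptic every solution is nonsingular (Silverman III.1.4), so `E_W(L)` is in bijection
  with Mathlib's nonsingular projective points and, through Mathlib's
  `WeierstrassCurve.Projective.Point.toAffineAddEquiv`, with Mathlib's affine points
  `(W.baseChange L).toAffine.Point` (= the prelude's `W⟮L⟯`, and `W.geomPoints` for `L = K̄`):
  `WeierstrassCurve.pointEquiv W : (W.baseChange L).toAffine.Point ≃ AlgPoints W.scheme L`, with
  `pointEquiv_zero` (`O ↦ [0, 1, 0]`), `pointEquiv_some` (`(x, y) ↦ [x, y, 1]`) and
  **Galois-equivariance** `smul_pointEquiv` for the coordinatewise actions of `Aut(L/K)` of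
  `Motives/AlgPoints` (`σ • P = Spec σ ≫ P`) and of `EllipticCurves/GaloisAction`.

What is **not** here: that `pointEquiv` is additive for the group-scheme structure on `E_W`
(AEC III.3.6), which is not yet constructed.

## References

* [SilvermanAEC2009] J. H. Silverman, *The Arithmetic of Elliptic Curves*, 2nd ed., GTM 106,
  Springer 2009: I.2, III.1 (Prop. 1.4), III.2, III.3.1(c).
* [Hartshorne1977] R. Hartshorne, *Algebraic Geometry*, GTM 52 (1977): II Ex. 2.14, 4.7.

## Design notes

Declarations taking the Weierstrass curve `W` are deliberate dot-notation extensions in Mathlib's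
`namespace WeierstrassCurve` (`W.schemePoint`, `W.pointEquiv`, …), as in the sibling preludes of
this directory; the two lemmas about Mathlib's `WeierstrassCurve.Projective.Nonsingular`
(`Nonsingular.ne_zero`, `nonsingular_of_equation`) are deliberate extensions of Mathlib's
`namespace WeierstrassCurve.Projective`; generic helpers live in the path namespace
`Literature.NumberTheory.EllipticCurves`.
-/

noncomputable section

open CategoryTheory AlgebraicGeometry MvPolynomial Literature.AlgebraicGeometry.Motives
open scoped WeierstrassCurve.Projective

universe u

namespace Literature.NumberTheory.EllipticCurves

/-- `![0, 1, 0] ≠ 0` in `L³`. [folklore] -/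
theorem fin3_zero_one_zero_ne_zero {L : Type u} [Field L] : (![0, 1, 0] : Fin 3 → L) ≠ 0 := fun h => by
  simpa using congrFun h 1

/-- `![x, y, 1] ≠ 0` in `L³`. [folklore] -/
theorem fin3_one_ne_zero {L : Type u} [Field L] (x y : L) : (![x, y, 1] : Fin 3 → L) ≠ 0 := fun h => by
  simpa using congrFun h 2

end Literature.NumberTheory.EllipticCurves

namespace WeierstrassCurve.Projective

/-- A nonsingular point representative is a non-zero vector (deliberate dot-notation extension of
Mathlib's `WeierstrassCurve.Projective.Nonsingular`). [folklore] -/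
theorem Nonsingular.ne_zero {L : Type u} [Field L] {W' : WeierstrassCurve.Projective L} {v : Fin 3 → L}
    (h : W'.Nonsingular v) : v ≠ 0 := by
  rintro rfl
  rw [Projective.nonsingular_iff] at h
  simp at h

/-- **On an elliptic curve every solution of the Weierstrass equation is nonsingular**
(Silverman, *AEC*, III.1.4: `Δ ≠ 0` iff the curve is nonsingular; Mathlib
`Affine.equation_iff_nonsingular` on the chart `Z ≠ 0`, and `[0, 1, 0]` is always nonsingular).
Deliberate extension of Mathlib's `namespace WeierstrassCurve.Projective` (Mathlib has the affine
version only). [cite: SilvermanAEC2009, III.1 Prop. 1.4(a)] -/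
theorem nonsingular_of_equation {L : Type u} [Field L] {W' : WeierstrassCurve.Projective L}
    [W'.IsElliptic] {v : Fin 3 → L} (hv : v ≠ 0) (hEq : W'.Equation v) : W'.Nonsingular v := by
  by_cases hz : v 2 = 0
  · have hx : v 0 = 0 := pow_eq_zero_iff (n := 3) (by norm_num) |>.mp
      ((Projective.equation_of_Z_eq_zero hz).mp hEq)
    have hy : v 1 ≠ 0 := by
      intro hy
      apply hv
      funext i
      fin_cases i
      · exact hx
      · exact hy
      · exact hz
    rw [Projective.nonsingular_of_Z_eq_zero hz]
    refine ⟨hEq, Or.inr ?_⟩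
    rw [hx]
    simpa using pow_ne_zero 2 hy
  · rw [Projective.nonsingular_of_Z_ne_zero hz]
    exact (Affine.equation_iff_nonsingular.mp ((Projective.equation_of_Z_ne_zero hz).mp hEq))

end WeierstrassCurve.Projective

namespace WeierstrassCurve

open Literature.NumberTheory.EllipticCurves

variable {K : Type u} [Field K] (W : WeierstrassCurve K) {L : Type u} [Field L] [Algebra K L]

/-! ### The Weierstrass equation over `L` -/

/-- `(W.baseChange L).toProjective` is `W.toProjective` mapped along `K → L` (`rfl`). [folklore] -/
theorem toProjective_baseChange :
    (W.baseChange L).toProjective = W.toProjective.map (algebraMap K L) :=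
  rfl

/-- Evaluating the Weierstrass cubic of `W` at `v ∈ L³` is evaluating the Weierstrass cubic of
`W_L` at `v`. [folklore] -/
theorem aeval_toProjective_polynomial (v : Fin 3 → L) :
    aeval v W.toProjective.polynomial = eval v (W.baseChange L).toProjective.polynomial := by
  rw [aeval_def, toProjective_baseChange, Projective.map_polynomial, eval_map]

/-- `F(v) = 0` iff `v` satisfies the homogeneous Weierstrass equation of `W_L`. [folklore] -/
theorem aeval_toProjective_polynomial_eq_zero_iff (v : Fin 3 → L) :
    aeval v W.toProjective.polynomial = 0 ↔ (W.baseChange L).toProjective.Equation v := by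
  rw [aeval_toProjective_polynomial]
  rfl

/-! ### Points of `E_W` with given homogeneous coordinates -/

/-- **The `L`-point of `E_W` with homogeneous coordinates `v`** (`v ≠ 0` a solution of the homogeneous
Weierstrass equation over `L`): Silverman, *AEC*, III.1–III.2 (`E(L) = {[X,Y,Z] ∈ ℙ²(L) : F = 0}`).
[cite: SilvermanAEC2009, III.2] -/
def schemePoint (v : Fin 3 → L) (hv : v ≠ 0) (hEq : (W.baseChange L).toProjective.Equation v) :
    AlgPoints W.scheme L :=
  SmoothHypersurface.pointOfVec (n := 1) W.toProjective.polynomial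
    W.toProjective.isHomogeneous_polynomial three_pos v hv ((W.aeval_toProjective_polynomial_eq_zero_iff v).mpr hEq)

/-- `schemePoint` pushed into `ℙ²_K` is the point with homogeneous coordinates `v`. [folklore] -/
@[simp]
theorem map_schemeι_schemePoint (v : Fin 3 → L) (hv : v ≠ 0)
    (hEq : (W.baseChange L).toProjective.Equation v) :
    AlgPoints.map W.schemeι (W.schemePoint v hv hEq) = ProjectiveSpace.pointOfVec K v hv :=
  SmoothHypersurface.map_hypersurfaceι_pointOfVec _ _ _ v hv _

/-- **Every `L`-point of `E_W` has homogeneous coordinates** solving the Weierstrass equation.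
[cite: SilvermanAEC2009, III.2] -/
theorem exists_eq_schemePoint (P : AlgPoints W.scheme L) :
    ∃ (v : Fin 3 → L) (hv : v ≠ 0) (hEq : (W.baseChange L).toProjective.Equation v),
      P = W.schemePoint v hv hEq := by
  obtain ⟨v, hv, hFv, rfl⟩ := SmoothHypersurface.exists_eq_pointOfVec (n := 1) W.toProjective.polynomial
    W.toProjective.isHomogeneous_polynomial three_pos P
  exact ⟨v, hv, (W.aeval_toProjective_polynomial_eq_zero_iff v).mp hFv, rfl⟩

/-- **Homogeneous coordinates on `E_W` are unique up to `Lˣ`.** [cite: SilvermanAEC2009, III.2] -/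
theorem schemePoint_eq_schemePoint_iff (v v' : Fin 3 → L) (hv : v ≠ 0) (hv' : v' ≠ 0)
    (hEq : (W.baseChange L).toProjective.Equation v) (hEq' : (W.baseChange L).toProjective.Equation v') :
    W.schemePoint v hv hEq = W.schemePoint v' hv' hEq' ↔ ∃ c : L, c ≠ 0 ∧ v' = c • v :=
  SmoothHypersurface.pointOfVec_eq_pointOfVec_iff _ _ _ v v' hv hv' _ _

/-- Equivalent representatives give the same point of `E_W`. [folklore] -/
theorem schemePoint_eq_of_equiv {v v' : Fin 3 → L} (h : v ≈ v') (hv : v ≠ 0) (hv' : v' ≠ 0)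
    (hEq : (W.baseChange L).toProjective.Equation v) (hEq' : (W.baseChange L).toProjective.Equation v') :
    W.schemePoint v hv hEq = W.schemePoint v' hv' hEq' := by
  obtain ⟨u, rfl⟩ := h
  exact ((W.schemePoint_eq_schemePoint_iff v' _ hv' hv hEq' hEq).mpr
    ⟨(u : L), u.ne_zero, (Units.smul_def u v').symm ▸ rfl⟩).symm

/-- **`Aut(L/K)` acts on homogeneous coordinates coordinatewise**: `σ • [v] = [σ ∘ v]` for the action
`σ • P = Spec σ ≫ P` of `Motives/AlgPoints`. Silverman, *AEC*, I.2; Hartshorne II Ex. 4.7.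
[cite: SilvermanAEC2009, I.2] -/
theorem smul_schemePoint (σ : L ≃ₐ[K] L) (v : Fin 3 → L) (hv : v ≠ 0)
    (hEq : (W.baseChange L).toProjective.Equation v)
    (hσv : (fun j => σ (v j)) ≠ 0) (hσEq : (W.baseChange L).toProjective.Equation fun j => σ (v j)) :
    σ • W.schemePoint v hv hEq = W.schemePoint (fun j => σ (v j)) hσv hσEq :=
  SmoothHypersurface.smul_pointOfVec _ σ _ _ v hv _ _

/-- The coordinatewise image of a solution under `σ ∈ Aut(L/K)` is a solution. [folklore] -/
theorem equation_algEquiv_comp (σ : L ≃ₐ[K] L) {v : Fin 3 → L}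
    (hEq : (W.baseChange L).toProjective.Equation v) :
    (W.baseChange L).toProjective.Equation fun j => σ (v j) := by
  rw [← aeval_toProjective_polynomial_eq_zero_iff] at hEq ⊢
  exact SmoothHypersurface.aeval_algEquiv_comp_eq_zero _ σ hEq

/-! ### `E_W(L)` and Mathlib's nonsingular projective points -/

/-- The `L`-point of `E_W` underlying a nonsingular projective point of `W_L` in Mathlib's sense
(through a chosen representative of the point class). [folklore] -/
def schemePointOfPoint (P : (W.baseChange L).toProjective.Point) : AlgPoints W.scheme L :=
  W.schemePoint P.point.out
    ((Projective.nonsingularLift_iff _).mp (P.point.out_eq.symm ▸ P.nonsingular)).ne_zero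
    ((Projective.nonsingularLift_iff _).mp (P.point.out_eq.symm ▸ P.nonsingular)).1

/-- `schemePointOfPoint ⟨⟦v⟧⟩` is the point with homogeneous coordinates `v`. [folklore] -/
theorem schemePointOfPoint_mk (v : Fin 3 → L) (h : (W.baseChange L).toProjective.NonsingularLift ⟦v⟧) :
    W.schemePointOfPoint ⟨h⟩ =
      W.schemePoint v ((Projective.nonsingularLift_iff v).mp h).ne_zero
        ((Projective.nonsingularLift_iff v).mp h).1 :=
  W.schemePoint_eq_of_equiv (Quotient.mk_out v) _ _ _ _

/-- `schemePointOfPoint` is injective (coordinates are unique up to `Lˣ`). [folklore] -/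
theorem schemePointOfPoint_injective : Function.Injective (W.schemePointOfPoint (L := L)) := by
  intro P Q h
  obtain ⟨c, hc, hcv⟩ :=
    (W.schemePoint_eq_schemePoint_iff P.point.out Q.point.out _ _ _ _).mp h
  ext
  rw [← Quotient.out_eq P.point, ← Quotient.out_eq Q.point, hcv, Projective.smul_eq _ hc.isUnit]

/-- For `W` elliptic, `schemePointOfPoint` is surjective (every solution is nonsingular).
[cite: SilvermanAEC2009, III.1 Prop. 1.4(a)] -/
theorem schemePointOfPoint_surjective [W.IsElliptic] :
    Function.Surjective (W.schemePointOfPoint (L := L)) := by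
  intro P
  obtain ⟨v, hv, hEq, rfl⟩ := W.exists_eq_schemePoint P
  haveI : (W.baseChange L).toProjective.IsElliptic :=
    inferInstanceAs ((W.map (algebraMap K L)).IsElliptic)
  have hns : (W.baseChange L).toProjective.Nonsingular v := Projective.nonsingular_of_equation hv hEq
  exact ⟨⟨(Projective.nonsingularLift_iff v).mpr hns⟩, W.schemePointOfPoint_mk v _⟩

/-- **`E_W(L)` is Mathlib's set of nonsingular projective points of `W_L`** (`W` elliptic).
Silverman, *AEC*, III.2 with III.1.4. [cite: SilvermanAEC2009, III.2] -/
def projectivePointEquiv [W.IsElliptic] : (W.baseChange L).toProjective.Point ≃ AlgPoints W.scheme L :=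
  Equiv.ofBijective _ ⟨W.schemePointOfPoint_injective, W.schemePointOfPoint_surjective⟩

/-- `projectivePointEquiv` is `schemePointOfPoint` (`rfl`). [folklore] -/
@[simp]
theorem projectivePointEquiv_apply [W.IsElliptic] (P : (W.baseChange L).toProjective.Point) :
    W.projectivePointEquiv P = W.schemePointOfPoint P :=
  rfl

/-! ### `E_W(L)` and Mathlib's affine points `W⟮L⟯` -/

/-- **`E_W(L) = W⟮L⟯`**: the bijection between Mathlib's nonsingular affine points of `W` over `L`
(with the point at infinity) and the `L`-valued points of the `K`-scheme `E_W`, `O ↦ [0, 1, 0]`,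
`(x, y) ↦ [x, y, 1]` (Silverman, *AEC*, III.1–III.2, III.3.1(c); composed from Mathlib's
`Projective.Point.toAffineAddEquiv` and `projectivePointEquiv`). [cite: SilvermanAEC2009, III.2] -/
def pointEquiv [W.IsElliptic] : (W.baseChange L).toAffine.Point ≃ AlgPoints W.scheme L :=
  haveI := Classical.decEq L
  (Projective.Point.toAffineAddEquiv (W.baseChange L).toProjective).symm.toEquiv.trans
    W.projectivePointEquiv

/-- **`pointEquiv O = [0, 1, 0]`.** [cite: SilvermanAEC2009, III.2] -/
theorem pointEquiv_zero [W.IsElliptic] :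
    W.pointEquiv (0 : (W.baseChange L).toAffine.Point) =
      W.schemePoint ![0, 1, 0] fin3_zero_one_zero_ne_zero Projective.equation_zero := by
  classical
  change W.schemePointOfPoint (Projective.Point.fromAffine 0) = _
  rw [Projective.Point.fromAffine_zero, Projective.Point.zero_def]
  exact W.schemePointOfPoint_mk _ _

/-- **`pointEquiv (x, y) = [x, y, 1]`.** [cite: SilvermanAEC2009, III.2] -/
theorem pointEquiv_some [W.IsElliptic] {x y : L} (h : (W.baseChange L).toAffine.Nonsingular x y) :
    W.pointEquiv (Affine.Point.some x y h) =
      W.schemePoint ![x, y, 1] (fin3_one_ne_zero x y) ((Projective.equation_some x y).mpr h.1) := by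
  classical
  change W.schemePointOfPoint (Projective.Point.fromAffine (Affine.Point.some x y h)) = _
  rw [Projective.Point.fromAffine_some]
  exact W.schemePointOfPoint_mk _ _

/-- **Galois-equivariance of `E_W(L) = W⟮L⟯`**: for `σ ∈ Aut(L/K)`, `σ • pointEquiv P = pointEquiv (σ • P)`,
where `σ` acts on `E_W(L)` by `σ • P = Spec σ ≫ P` (`Motives/AlgPoints`) and on `W⟮L⟯` coordinatewise
(`EllipticCurves/GaloisAction`, `σ • P = Affine.Point.map σ P`). Silverman, *AEC*, I.2; Hartshorne II
Ex. 4.7. [cite: SilvermanAEC2009, I.2] -/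
theorem smul_pointEquiv [W.IsElliptic] (σ : L ≃ₐ[K] L) (P : (W.baseChange L).toAffine.Point) :
    σ • W.pointEquiv P = W.pointEquiv (σ • P) := by
  classical
  rcases P with _ | ⟨x, y, h⟩
  · have h0 : σ • (0 : (W.baseChange L).toAffine.Point) = 0 := smul_zero σ
    rw [← Affine.Point.zero_def, h0, pointEquiv_zero,
      W.smul_schemePoint σ _ _ _ (ProjectiveSpace.algEquiv_comp_ne_zero σ fin3_zero_one_zero_ne_zero)
        (W.equation_algEquiv_comp σ Projective.equation_zero)]
    congr 1
    funext j
    fin_cases j <;> simp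
  · rw [smul_def, Affine.Point.map_some, pointEquiv_some, pointEquiv_some,
      W.smul_schemePoint σ _ _ _ (ProjectiveSpace.algEquiv_comp_ne_zero σ (fin3_one_ne_zero x y))
        (W.equation_algEquiv_comp σ ((Projective.equation_some x y).mpr h.1))]
    congr 1
    funext j
    fin_cases j <;> simp

end WeierstrassCurve
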